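import Summits.FinalStateConjecture.FinalStateConjecture.Theses.PhaseMixingCapture
import Summits.FinalStateConjecture.FinalStateConjecture.Theorems.KerrShieldedDataExist.Negative.BentHeight
import Literature.Geometry.Lorentzian.FinalState
import Literature.Geometry.Lorentzian.KerrStarChartBounds
import Literature.Geometry.Lorentzian.LeviCivitaProofs
import Literature.Geometry.Riemannian.CompleteManifoldBoundedSets
import HarnessLib

/-!
# Crux `PhaseMixingCapture.WeakCosmicCensorshipMGHD` (stmt-FinalStateConjecture-9952), line
# `scri-transfer-third-of-burial`, stub `stub_shieldCocompact`

**Far shield regions of an admissible Kerr-shielded datum are co-compact.**  Let `D` be an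
admissible datum on `X` (in particular `(X, h)` is complete) which is Kerr-shielded by
`φ : Kerr.slice a r₁ → X` (a smooth open embedding with compact complement `C = (range φ)ᶜ`,
with `φ^* h = ψ^* g_{M,a}` for the bent Kerr–Schild slice `ψ`).  Then for every `R` there is a
compact `K ⊆ X` with `Kᶜ ⊆ φ {R ≤ r}`; namely `K = C ∪ closure (φ{r < R})`, because:

* `pullback_le` — on `{r < 4M}` the bent height `bentHeight M a` vanishes
  (`bentHeight_eq_zero_of_le`), so there `ψ` is the flat slice map `y ↦ (0, y)` and
  `φ^* h = δ + 2H ℓ⃗ ⊗ ℓ⃗ ≤ (1 + 2M/r₁) δ` (`H ≤ M/r`, `|ℓ⃗| = 1`; Cook 2000, (55));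
* `edist_ray_le` — the Euclidean ray `t ↦ (1 + t²) y` from a slice point `y` with `‖y‖ < ρ`,
  `ρ < 4M`, stays in the slice (the Kerr–Schild radius increases along rays,
  `radius_le_radius_smul`) and in `{r ≤ ‖·‖ ≤ ρ}`, and reaches the sphere `{‖y‖ = ρ}`; its
  `φ`-image is a `C¹` path of `h`-length `≤ 2 √(1 + 2M/r₁) ρ` (`d ≤ L = ∫ |γ'|`, O'Neill 1983,
  Ch. 5, Def. 15), so `d_h(φ y, φ{‖·‖ = ρ})` is bounded;
* `exists_isCompact_core` — with `ρ² = r₊² + a² < 16M²`: every point of `φ{r < R}` has `‖y‖ < ρ`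
  or lies in the compact `φ{ρ ≤ ‖y‖ ≤ ρ + √(R² + a²)}` (`‖y‖² ≤ r² + a²`), hence `φ{r < R}` is
  `h`-bounded and its closure is compact by **Hopf–Rinow** for the complete metric `h`
  (`isCompact_closure_of_forall_edist_le`; O'Neill 1983, Ch. 5, Thm. 21, (C) ⇒ (HB)).

Only completeness of the admissible datum is used (not the sole end); on the coreless carrier
`X = Kerr.slice a r₁`, `φ = id`, the inner edge `{r → r₁⁺}` is at finite distance and the
conclusion fails, as it must.

References: B. O'Neill, *Semi-Riemannian geometry* (1983), Ch. 5, Def. 15, Prop. 18, Thm. 21;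
D. Christodoulou, CQG 16 (1999) A23, p. A24; G. B. Cook, Living Rev. Relativ. 3 (2000) 5,
§3.2.2, (55); M. Visser, arXiv:0706.0622, (33)–(35).
-/

set_option linter.dupNamespace false

noncomputable section

open scoped Manifold ContDiff Topology ENNReal NNReal
open Set Function Topology Literature.Geometry.Lorentzian
open Summit.FinalStateConjecture.FinalStateConjecture.Theorems.KerrShieldedDataExist.Negative
  (bentHeight bentHeight_eq_zero_of_le rPlus_le_two_mul)

namespace Summit.FinalStateConjecture.FinalStateConjecture.Theorems.PhaseMixingCapture.WeakCosmicCensorshipMGHD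

/-! ## The Kerr–Schild radius increases along Euclidean rays -/

/-- `u ↦ u + √(u² + c)` is monotone in `u` and in `c ≥ 0`. [folklore] -/
private theorem add_sqrt_le {u u' c c' : ℝ} (hu : u ≤ u') (hc : 0 ≤ c) (hcc : c ≤ c') :
    u + Real.sqrt (u ^ 2 + c) ≤ u' + Real.sqrt (u' ^ 2 + c') := by
  have h1 : Real.sqrt (u' ^ 2 + c) ≤ Real.sqrt (u' ^ 2 + c') := Real.sqrt_le_sqrt (by linarith)
  suffices h : Real.sqrt (u ^ 2 + c) ≤ (u' - u) + Real.sqrt (u' ^ 2 + c) by linarith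
  set S' := Real.sqrt (u' ^ 2 + c) with hS'
  have hS'0 : 0 ≤ S' := Real.sqrt_nonneg _
  have hS'2 : S' ^ 2 = u' ^ 2 + c := Real.sq_sqrt (by positivity)
  have habs : |u'| ≤ S' := by
    rw [hS', ← Real.sqrt_sq_eq_abs]
    exact Real.sqrt_le_sqrt (by linarith)
  have hu'S' : 0 ≤ u' + S' := by linarith [neg_le_abs u']
  refine Real.sqrt_le_iff.2 ⟨by linarith, ?_⟩
  nlinarith [mul_nonneg (sub_nonneg.2 hu) hu'S']

/-- The Kerr–Schild radius `r(0, y)` does not decrease along the Euclidean ray `s ↦ s y`,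
`s ≥ 1` (from `r² = ((ρ² − a²) + √((ρ² − a²)² + 4a²z²))/2`, Visser arXiv:0706.0622, (35)).
[folklore] -/
private theorem radius_le_radius_smul (a : ℝ) (y : E3) {s : ℝ} (hs : 1 ≤ s) :
    Kerr.radius a (E4.ofTimeSpace 0 y) ≤ Kerr.radius a (E4.ofTimeSpace 0 (s • y)) := by
  have h3 : E4.ofTimeSpace 0 y 3 = y 2 := E4.ofTimeSpace_apply_succ 0 y 2
  have h3' : E4.ofTimeSpace 0 (s • y) 3 = s * y 2 := by
    rw [show E4.ofTimeSpace 0 (s • y) 3 = (s • y) 2 from E4.ofTimeSpace_apply_succ 0 (s • y) 2]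
    simp
  have hs0 : 0 ≤ s := zero_le_one.trans hs
  unfold Kerr.radius
  rw [E4.spatialNorm_ofTimeSpace, E4.spatialNorm_ofTimeSpace, h3, h3', norm_smul,
    Real.norm_of_nonneg hs0]
  apply Real.sqrt_le_sqrt
  have hy : 0 ≤ ‖y‖ := norm_nonneg y
  have hs1 : 0 ≤ (s - 1) * (s + 1) := mul_nonneg (sub_nonneg.2 hs) (by linarith)
  have hy2 : ‖y‖ ^ 2 ≤ (s * ‖y‖) ^ 2 := by nlinarith [mul_nonneg hs1 (sq_nonneg ‖y‖)]
  have hz2 : 4 * a ^ 2 * y 2 ^ 2 ≤ 4 * a ^ 2 * (s * y 2) ^ 2 := by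
    have : y 2 ^ 2 ≤ (s * y 2) ^ 2 := by nlinarith [mul_nonneg hs1 (sq_nonneg (y 2))]
    nlinarith [sq_nonneg a]
  have := add_sqrt_le (u := ‖y‖ ^ 2 - a ^ 2) (u' := (s * ‖y‖) ^ 2 - a ^ 2) (by linarith)
    (by positivity) hz2
  linarith

/-! ## The pulled-back metric near the inner edge -/

/-- **`φ^* h = ψ^* g ≤ (1 + 2M/r₁) δ` on `{r < 4M}`.**  There the bent height vanishes, `ψ` is the
flat slice map with differential `v ↦ (0, v)`, and `g((0,v),(0,v)) = ‖v‖² + 2H (ℓ⃗·v)²` with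
`0 ≤ 2H ≤ 2M/r ≤ 2M/r₁` and `|ℓ⃗| = 1` (Cook 2000, §3.2.2, (55)). [cite: Cook2000, §3.2.2 (55)] -/
private theorem pullback_le [Kerr.Facts] {M a r₁ : ℝ} (ha : |a| < M) (hr₁ : Kerr.rMinus M a < r₁)
    {ψ : Kerr.slice a r₁ → Kerr.region a r₁}
    (hψ : ∀ y : Kerr.slice a r₁, (ψ y : E4) =
      E4.ofTimeSpace (bentHeight M a (Kerr.radius a (E4.ofTimeSpace 0 (y : E3)))) (y : E3))
    {z : Kerr.slice a r₁} (hz : Kerr.radius a (E4.ofTimeSpace 0 (z : E3)) < 4 * M) (u : E3) :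
    pullbackBilin (I := 𝓘(ℝ, E4)) (I' := 𝓘(ℝ, E3)) ψ (Kerr.smoothMetric M a r₁).val z u u ≤
      (1 + 2 * M / r₁) * ‖u‖ ^ 2 := by
  have hM : 0 < M := (abs_nonneg a).trans_lt ha
  have hr₁0 : 0 < r₁ := (Kerr.IsSubextremal.rMinus_nonneg ha).trans_lt hr₁
  have hzr : r₁ < Kerr.radius a (E4.ofTimeSpace 0 (z : E3)) := Kerr.lt_radius_of_mem_region z.2
  have hr0 : 0 < Kerr.radius a (E4.ofTimeSpace 0 (z : E3)) := hr₁0.trans hzr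
  -- `ψ` is the flat slice map near `z`
  have hU : IsOpen {w : Kerr.slice a r₁ | Kerr.radius a (E4.ofTimeSpace 0 (w : E3)) < 4 * M} :=
    isOpen_lt ((Kerr.continuous_radius a).comp
      ((E4.continuous_ofTimeSpace 0).comp continuous_subtype_val)) continuous_const
  have heq : ψ =ᶠ[𝓝 z] Kerr.sliceEmbed a r₁ := by
    filter_upwards [hU.mem_nhds hz] with w hw
    exact Subtype.ext (by rw [hψ w, Kerr.coe_sliceEmbed, bentHeight_eq_zero_of_le hM hw.le])
  have hz0 : (ψ z : E4) = E4.ofTimeSpace 0 (z : E3) := by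
    rw [hψ z, bentHeight_eq_zero_of_le hM hz.le]
  have key : pullbackBilin (I := 𝓘(ℝ, E4)) (I' := 𝓘(ℝ, E3)) ψ (Kerr.smoothMetric M a r₁).val z u u =
      Kerr.bilin M a (E4.ofTimeSpace 0 (z : E3)) (E4.spaceEmbed u) (E4.spaceEmbed u) := by
    rw [pullbackBilin_apply, heq.mfderiv_eq, Kerr.mfderiv_sliceEmbed, Kerr.smoothMetric_val, hz0]
    rfl
  rw [key, Kerr.bilin_spaceEmbed_spaceEmbed]
  set x : E4 := E4.ofTimeSpace 0 (z : E3) with hx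
  -- `(ℓ⃗ · u)² ≤ ‖u‖²`
  have hℓ : Kerr.nullCovector a x (E4.spaceEmbed u) ^ 2 ≤ ‖u‖ ^ 2 := by
    have hsum := Kerr.sum_sq_nullCovectorFun hr0
    have e1 : E4.ofTimeSpace 0 u 1 = u 0 := E4.ofTimeSpace_apply_succ 0 u 0
    have e2 : E4.ofTimeSpace 0 u 2 = u 1 := E4.ofTimeSpace_apply_succ 0 u 1
    have e3 : E4.ofTimeSpace 0 u 3 = u 2 := E4.ofTimeSpace_apply_succ 0 u 2
    rw [Kerr.nullCovector, E4.covector_apply, Fin.sum_univ_four, EuclideanSpace.real_norm_sq_eq,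
      Fin.sum_univ_three]
    simp only [E4.spaceEmbed_apply, E4.ofTimeSpace_apply_zero, mul_zero, zero_add, e1, e2, e3]
    set l1 := Kerr.nullCovectorFun a x 1
    set l2 := Kerr.nullCovectorFun a x 2
    set l3 := Kerr.nullCovectorFun a x 3
    have key : (u 0 ^ 2 + u 1 ^ 2 + u 2 ^ 2) - (l1 * u 0 + l2 * u 1 + l3 * u 2) ^ 2 =
        (l1 * u 1 - l2 * u 0) ^ 2 + (l1 * u 2 - l3 * u 0) ^ 2 + (l2 * u 2 - l3 * u 1) ^ 2 := by
      linear_combination (-(u 0 ^ 2 + u 1 ^ 2 + u 2 ^ 2)) * hsum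
    nlinarith [key, sq_nonneg (l1 * u 1 - l2 * u 0), sq_nonneg (l1 * u 2 - l3 * u 0),
      sq_nonneg (l2 * u 2 - l3 * u 1)]
  have hH0 : 0 ≤ Kerr.scalarH M a x := Kerr.scalarH_nonneg hM.le a x
  have hH : Kerr.scalarH M a x ≤ M / Kerr.radius a x := Kerr.scalarH_le_div hM.le a hr0
  have hdiv : M / Kerr.radius a x ≤ M / r₁ := div_le_div_of_nonneg_left hM.le hr₁0 hzr.le
  have h1 : 2 * Kerr.scalarH M a x * Kerr.nullCovector a x (E4.spaceEmbed u) ^ 2 ≤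
      2 * (M / r₁) * ‖u‖ ^ 2 :=
    mul_le_mul (by linarith) hℓ (sq_nonneg _) (by positivity)
  calc ‖u‖ ^ 2 + 2 * Kerr.scalarH M a x * Kerr.nullCovector a x (E4.spaceEmbed u) ^ 2
      ≤ ‖u‖ ^ 2 + 2 * (M / r₁) * ‖u‖ ^ 2 := by linarith
    _ = (1 + 2 * M / r₁) * ‖u‖ ^ 2 := by ring

/-! ## The inner collar is bounded for `h` -/

/-- **Rays out of the inner collar have bounded `h`-length.**  For a datum `D` whose metric pulls
back along `φ` to the bent slice metric `ψ^* g_{M,a}`, a slice point `y` with `‖y‖ < ρ`,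
`ρ < 4M`, is joined to a point `y'` of the Euclidean sphere `{‖y'‖ = ρ}` (the end of the ray
`t ↦ (1 + t²) y`, `0 ≤ t ≤ t₁`) with `d_h(φ y, φ y') ≤ 2 √(1 + 2M/r₁) ρ`: the `φ`-image of the ray
is `C¹` with `h`-speed `√(φ^*h(2t y, 2t y)) ≤ √(1 + 2M/r₁) · 2 t₁ ‖y‖` (`pullback_le`), and
`d ≤ L = ∫ |γ'|` (O'Neill 1983, Ch. 5, Def. 15). [cite: ONeill1983, Ch. 5, Def. 15 (p. 134)] -/
private theorem edist_ray_le [Kerr.Facts] {X : Type*} [TopologicalSpace X] [ChartedSpace E3 X]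
    [IsManifold (𝓡 3) ∞ X] (D : InitialDataSet (𝓡 3) X) {M a r₁ : ℝ} (ha : |a| < M)
    (hr₁ : Kerr.rMinus M a < r₁) {φ : Kerr.slice a r₁ → X}
    (hφs : ContMDiff 𝓘(ℝ, E3) (𝓡 3) ∞ φ) {ψ : Kerr.slice a r₁ → Kerr.region a r₁}
    (hψ : ∀ y : Kerr.slice a r₁, (ψ y : E4) =
      E4.ofTimeSpace (bentHeight M a (Kerr.radius a (E4.ofTimeSpace 0 (y : E3)))) (y : E3))
    (hh : ∀ y : Kerr.slice a r₁, pullbackBilin (I := 𝓡 3) (I' := 𝓘(ℝ, E3)) φ D.h.inner y =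
      pullbackBilin (I := 𝓘(ℝ, E4)) (I' := 𝓘(ℝ, E3)) ψ (Kerr.smoothMetric M a r₁).val y)
    {ρ : ℝ} (hρ : ρ < 4 * M) (y : Kerr.slice a r₁) (hy : ‖(y : E3)‖ < ρ) :
    ∃ y' : Kerr.slice a r₁, ‖(y' : E3)‖ = ρ ∧
      D.metric.edist D.isRiemannian_metric (φ y) (φ y') ≤
        ENNReal.ofReal (2 * Real.sqrt (1 + 2 * M / r₁) * ρ) := by
  have hg := D.isRiemannian_metric
  have hM : 0 < M := (abs_nonneg a).trans_lt ha
  have hr₁0 : 0 < r₁ := (Kerr.IsSubextremal.rMinus_nonneg ha).trans_lt hr₁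
  have hrad : ∀ w : Kerr.slice a r₁, r₁ < Kerr.radius a (E4.ofTimeSpace 0 (w : E3)) := fun w ↦
    Kerr.lt_radius_of_mem_region w.2
  set n : ℝ := ‖(y : E3)‖ with hn
  have hn0 : 0 < n :=
    (hr₁0.trans (hrad y)).trans_le (Kerr.radius_le_norm (hr₁0.trans (hrad y)))
  set t₁ : ℝ := Real.sqrt (ρ / n - 1) with ht₁def
  have ht₁ : 0 ≤ t₁ := Real.sqrt_nonneg _
  have ht₁sq : t₁ ^ 2 = ρ / n - 1 :=
    Real.sq_sqrt (by rw [sub_nonneg, le_div_iff₀ hn0]; linarith)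
  have ht₁n : (1 + t₁ ^ 2) * n = ρ := by rw [ht₁sq]; field_simp; ring
  -- the ray `σ` in the slice and its image `γ` in `X`
  have hmem : ∀ t : ℝ, (1 + t ^ 2) • (y : E3) ∈ Kerr.slice a r₁ := fun t ↦ by
    rw [Kerr.mem_slice]
    exact lt_of_lt_of_le y.2 (radius_le_radius_smul a _ (by nlinarith [sq_nonneg t]))
  set σ : ℝ → Kerr.slice a r₁ := fun t ↦ ⟨(1 + t ^ 2) • (y : E3), hmem t⟩ with hσ
  have hnorm : ∀ t, ‖(σ t : E3)‖ = (1 + t ^ 2) * n := fun t ↦ by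
    show ‖(1 + t ^ 2) • (y : E3)‖ = _
    rw [norm_smul, Real.norm_of_nonneg (by positivity)]
  have hσ0 : σ 0 = y := Subtype.ext (by show (1 + (0 : ℝ) ^ 2) • (y : E3) = y; simp)
  refine ⟨σ t₁, by rw [hnorm, ht₁n], ?_⟩
  have hσ₀ : ContMDiff 𝓘(ℝ, ℝ) 𝓘(ℝ, E3) ∞ (fun t : ℝ ↦ (1 + t ^ 2) • (y : E3)) := by
    rw [contMDiff_iff_contDiff]
    exact (contDiff_const.add (contDiff_id.pow 2)).smul contDiff_const
  have hσs : ContMDiff 𝓘(ℝ, ℝ) 𝓘(ℝ, E3) ∞ σ := fun t ↦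
    (ChartedSpace.liftPropWithinAt_subtypeVal_comp_iff σ univ t).mp (hσ₀ t)
  have hσd : ∀ t : ℝ, HasMFDerivAt 𝓘(ℝ, ℝ) 𝓘(ℝ, E3) σ t
      ((1 : ℝ →L[ℝ] ℝ).smulRight ((2 * t) • (y : E3))) := fun t ↦ by
    refine OpensChart.hasMFDerivAt_codRestrict (f := fun t : ℝ ↦ (1 + t ^ 2) • (y : E3))
      (fun _ ↦ rfl) ?_
    rw [hasMFDerivAt_iff_hasFDerivAt]
    have h1 : HasDerivAt (fun t : ℝ ↦ 1 + t ^ 2) (2 * t) t := by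
      simpa using (hasDerivAt_pow 2 t).const_add 1
    exact (h1.smul_const (y : E3)).hasFDerivAt
  have hφd : ∀ w, MDifferentiableAt 𝓘(ℝ, E3) (𝓡 3) φ w := fun w ↦
    (hφs w).mdifferentiableAt (by simp)
  have hγs : ContMDiffOn 𝓘(ℝ, ℝ) (𝓡 3) 1 (φ ∘ σ) (Icc 0 t₁) :=
    ((hφs.comp hσs).of_le (by exact_mod_cast le_top)).contMDiffOn
  have hvel : ∀ t, mfderiv 𝓘(ℝ, ℝ) (𝓡 3) (φ ∘ σ) t 1 =
      mfderiv 𝓘(ℝ, E3) (𝓡 3) φ (σ t) ((2 * t) • (y : E3)) := fun t ↦ by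
    rw [mfderiv_comp t (hφd (σ t)) (hσd t).mdifferentiableAt, (hσd t).mfderiv]
    show mfderiv 𝓘(ℝ, E3) (𝓡 3) φ (σ t) ((1 : ℝ) • ((2 * t) • (y : E3))) = _
    rw [one_smul]
  -- the speed bound along the ray
  set Λ : ℝ := 1 + 2 * M / r₁ with hΛ
  have hΛ0 : 0 ≤ Λ := by positivity
  have hbound : ∀ t ∈ Icc (0 : ℝ) t₁,
      D.metric.val ((φ ∘ σ) t) (mfderiv 𝓘(ℝ, ℝ) (𝓡 3) (φ ∘ σ) t 1)
        (mfderiv 𝓘(ℝ, ℝ) (𝓡 3) (φ ∘ σ) t 1) ≤ Λ * (2 * t₁ * n) ^ 2 := by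
    intro t ht
    rw [hvel t]
    have hlt : Kerr.radius a (E4.ofTimeSpace 0 (σ t : E3)) < 4 * M := by
      have h1 := Kerr.radius_le_norm (hr₁0.trans (hrad (σ t)))
      rw [hnorm] at h1
      have h2 : (1 + t ^ 2) * n ≤ (1 + t₁ ^ 2) * n := by
        nlinarith [mul_le_mul_of_nonneg_right (pow_le_pow_left₀ ht.1 ht.2 2) hn0.le]
      linarith
    show pullbackBilin (I := 𝓡 3) (I' := 𝓘(ℝ, E3)) φ D.h.inner (σ t) ((2 * t) • (y : E3))
      ((2 * t) • (y : E3)) ≤ _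
    rw [hh (σ t)]
    refine (pullback_le ha hr₁ hψ hlt _).trans ?_
    rw [norm_smul, Real.norm_of_nonneg (by linarith [ht.1] : (0 : ℝ) ≤ 2 * t)]
    have h3 : 2 * t * n ≤ 2 * t₁ * n := by nlinarith [ht.2]
    have h4 : (2 * t * n) ^ 2 ≤ (2 * t₁ * n) ^ 2 :=
      pow_le_pow_left₀ (by nlinarith [ht.1]) h3 2
    exact mul_le_mul_of_nonneg_left h4 hΛ0
  -- the length of `φ ∘ σ` on `[0, t₁]`
  have hlen : D.metric.length hg (φ ∘ σ) 0 t₁ ≤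
      ENNReal.ofReal (Real.sqrt Λ * (2 * t₁ * n)) * ENNReal.ofReal t₁ := by
    rw [PseudoRiemannianMetric.length_eq_lintegral]
    calc ∫⁻ t in Icc 0 t₁, ENNReal.ofReal (Real.sqrt (D.metric.val ((φ ∘ σ) t)
          (mfderiv 𝓘(ℝ, ℝ) (𝓡 3) (φ ∘ σ) t 1) (mfderiv 𝓘(ℝ, ℝ) (𝓡 3) (φ ∘ σ) t 1)))
        ≤ ∫⁻ _ in Icc 0 t₁, ENNReal.ofReal (Real.sqrt Λ * (2 * t₁ * n)) := by
          refine MeasureTheory.setLIntegral_mono measurable_const fun t ht ↦ ?_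
          refine ENNReal.ofReal_le_ofReal ?_
          calc Real.sqrt _ ≤ Real.sqrt (Λ * (2 * t₁ * n) ^ 2) := Real.sqrt_le_sqrt (hbound t ht)
            _ = Real.sqrt Λ * (2 * t₁ * n) := by
                rw [Real.sqrt_mul hΛ0, Real.sqrt_sq (by positivity)]
      _ = ENNReal.ofReal (Real.sqrt Λ * (2 * t₁ * n)) * ENNReal.ofReal t₁ := by
          rw [MeasureTheory.setLIntegral_const, Real.volume_Icc, sub_zero]
  have h0 : φ y = (φ ∘ σ) 0 := by simp [hσ0]
  calc D.metric.edist hg (φ y) (φ (σ t₁))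
      = D.metric.edist hg ((φ ∘ σ) 0) ((φ ∘ σ) t₁) := by rw [h0]; rfl
    _ ≤ D.metric.length hg (φ ∘ σ) 0 t₁ := PseudoRiemannianMetric.edist_le_length hg ht₁ hγs
    _ ≤ ENNReal.ofReal (Real.sqrt Λ * (2 * t₁ * n)) * ENNReal.ofReal t₁ := hlen
    _ = ENNReal.ofReal (Real.sqrt Λ * (2 * t₁ * n) * t₁) :=
        (ENNReal.ofReal_mul (by positivity)).symm
    _ ≤ ENNReal.ofReal (2 * Real.sqrt Λ * ρ) := ENNReal.ofReal_le_ofReal (by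
        have h1 : t₁ * t₁ * n = ρ - n := by rw [← sq, ht₁sq]; field_simp
        have h2 : 0 ≤ Real.sqrt Λ := Real.sqrt_nonneg _
        nlinarith [mul_nonneg h2 hn0.le])

/-- **A compact core containing `C ∪ φ{r < R}`.**  For an admissible (hence complete) datum
shielded through `φ`, the set `φ{r < R}` is within bounded `h`-distance of the compact set
`φ{ρ ≤ ‖y‖ ≤ ρ + √(R² + a²)}`, `ρ² = r₊² + a²` (`edist_ray_le` for `‖y‖ < ρ`; `‖y‖² ≤ r² + a²`
otherwise), so by Hopf–Rinow for the complete metric `h` (O'Neill 1983, Ch. 5, Thm. 21,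
(C) ⇒ (HB)) its closure is compact. [cite: ONeill1983, Ch. 5, Thm. 21] -/
private theorem exists_isCompact_core [Kerr.Facts] {X : Type*} [TopologicalSpace X]
    [ChartedSpace E3 X] [IsManifold (𝓡 3) ∞ X] [T2Space X] [ConnectedSpace X]
    {D : InitialDataSet (𝓡 3) X} (hD : D ∈ admissibleVacuumData X) {M a r₁ : ℝ} (ha : |a| < M)
    (hr₁ : Kerr.rMinus M a < r₁) (hr₂ : r₁ < Kerr.rPlus M a) {φ : Kerr.slice a r₁ → X}
    (hC : IsCompact (Set.range φ)ᶜ) (hφo : Topology.IsOpenEmbedding φ)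
    (hφs : ContMDiff 𝓘(ℝ, E3) (𝓡 3) ∞ φ) {ψ : Kerr.slice a r₁ → Kerr.region a r₁}
    (hψ : ∀ y : Kerr.slice a r₁, (ψ y : E4) =
      E4.ofTimeSpace (bentHeight M a (Kerr.radius a (E4.ofTimeSpace 0 (y : E3)))) (y : E3))
    (hh : ∀ y : Kerr.slice a r₁, pullbackBilin (I := 𝓡 3) (I' := 𝓘(ℝ, E3)) φ D.h.inner y =
      pullbackBilin (I := 𝓘(ℝ, E4)) (I' := 𝓘(ℝ, E3)) ψ (Kerr.smoothMetric M a r₁).val y)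
    (R : ℝ) :
    ∃ K₀ : Set X, IsCompact K₀ ∧ (Set.range φ)ᶜ ⊆ K₀ ∧
      φ '' {y : Kerr.slice a r₁ | Kerr.radius a (E4.ofTimeSpace 0 (y : E3)) < R} ⊆ K₀ := by
  have hM : 0 < M := (abs_nonneg a).trans_lt ha
  have hr₁0 : 0 < r₁ := (Kerr.IsSubextremal.rMinus_nonneg ha).trans_lt hr₁
  haveI := D.metric.hasLeviCivita
  haveI : CovariantDerivative.ContMDiffCovariantDerivative D.metric.leviCivita 1 :=
    ⟨D.metric.isLocallyContMDiff_leviCivita_holds 1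
      (by rw [show ((1 : ℕ∞) : ℕ∞ω) + 1 = 2 by norm_num]; exact WithTop.coe_le_coe.2 le_top)
      univ isOpen_univ⟩
  have hc : IsGeodesicallyComplete D.metric.leviCivita := isComplete_of_mem_admissibleVacuumData hD
  have hg := D.isRiemannian_metric
  haveI : LocallyCompactSpace X := Manifold.locallyCompact_of_finiteDimensional (𝓡 3)
  haveI : RegularSpace X := inferInstance
  -- `ρ² = r₊² + a² < 16 M²`; points with `ρ ≤ ‖x‖` lie in the slice
  set ρ : ℝ := Real.sqrt (Kerr.rPlus M a ^ 2 + a ^ 2) with hρdef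
  have hρ0 : 0 ≤ ρ := Real.sqrt_nonneg _
  have hρsq : ρ ^ 2 = Kerr.rPlus M a ^ 2 + a ^ 2 := Real.sq_sqrt (by positivity)
  have hρ4 : ρ < 4 * M := by
    rw [hρdef, Real.sqrt_lt' (by positivity)]
    have h := abs_lt.1 ha
    nlinarith [rPlus_le_two_mul ha, hr₁0.trans hr₂, sq_abs a, abs_nonneg a]
  have hle : ∀ x : E3, ‖x‖ ^ 2 - a ^ 2 ≤ Kerr.radius a (E4.ofTimeSpace 0 x) ^ 2 := fun x ↦ by
    simpa only [E4.spatialNorm_ofTimeSpace] using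
      Kerr.spatialNorm_sq_sub_sq_le_radius_sq a (E4.ofTimeSpace 0 x)
  have hbig : ∀ x : E3, ρ ≤ ‖x‖ → x ∈ Kerr.slice a r₁ := fun x hx ↦ by
    have h2 : ρ ^ 2 ≤ ‖x‖ ^ 2 := pow_le_pow_left₀ hρ0 hx 2
    have h3 : r₁ < Kerr.radius a (E4.ofTimeSpace 0 x) :=
      lt_of_pow_lt_pow_left₀ 2 (Kerr.radius_nonneg _ _) (by nlinarith [hle x])
    exact max_lt h3 (hr₁0.trans h3)
  -- the compact anchor `A = φ{ρ ≤ ‖y‖ ≤ R₂}` and the base point `p`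
  set R₂ : ℝ := ρ + Real.sqrt (R ^ 2 + a ^ 2) with hR₂
  set Q : Set (Kerr.slice a r₁) := {z | ρ ≤ ‖(z : E3)‖ ∧ ‖(z : E3)‖ ≤ R₂} with hQdef
  have hQ : IsCompact Q := by
    have hT : IsCompact {x : E3 | ρ ≤ ‖x‖ ∧ ‖x‖ ≤ R₂} :=
      (isCompact_closedBall (0 : E3) R₂).of_isClosed_subset
        ((isClosed_le continuous_const continuous_norm).inter
          (isClosed_le continuous_norm continuous_const))
        fun x hx ↦ mem_closedBall_zero_iff.2 hx.2
    exact Topology.IsInducing.subtypeVal.isCompact_preimage' hT fun x hx ↦ by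
      rw [Subtype.range_coe]
      exact hbig x hx.1
  obtain ⟨x₁, hx₁⟩ := (NormedSpace.sphere_nonempty (E := E3) (x := 0)).2 hρ0
  have hx₁' : ‖x₁‖ = ρ := mem_sphere_zero_iff_norm.1 hx₁
  set p : X := φ ⟨x₁, hbig x₁ hx₁'.ge⟩ with hp
  have hAc : IsCompact (φ '' Q) := hQ.image hφo.continuous
  have hρR₂ : ρ ≤ R₂ := le_add_of_nonneg_right (Real.sqrt_nonneg _)
  have hpA : p ∈ φ '' Q := ⟨⟨x₁, hbig x₁ hx₁'.ge⟩, ⟨hx₁'.ge, hx₁'.le.trans hρR₂⟩, rfl⟩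
  set f : X → ℝ≥0∞ := fun x ↦ D.metric.edist hg p x with hf
  have hfc : Continuous f :=
    (PseudoRiemannianMetric.continuous_edist hg).comp (Continuous.prodMk_right p)
  obtain ⟨x₀, -, hx₀⟩ := hAc.exists_isMaxOn ⟨p, hpA⟩ hfc.continuousOn
  -- every point of `φ{r < R}` is within distance `d(p, x₀) + c` of `p`
  set c : ℝ := 2 * Real.sqrt (1 + 2 * M / r₁) * ρ with hcdef
  have hc0 : 0 ≤ c := by positivity
  have hB : ∀ x ∈ φ '' {y : Kerr.slice a r₁ | Kerr.radius a (E4.ofTimeSpace 0 (y : E3)) < R},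
      f x ≤ ENNReal.ofReal ((f x₀).toReal + c) := by
    rintro _ ⟨z, hz, rfl⟩
    rw [ENNReal.ofReal_add ENNReal.toReal_nonneg hc0,
      ENNReal.ofReal_toReal (PseudoRiemannianMetric.edist_ne_top hg _ _)]
    by_cases hzn : ‖(z : E3)‖ < ρ
    · -- inner part: leave along the ray
      obtain ⟨z', hz', hdist⟩ := edist_ray_le D ha hr₁ hφs hψ hh hρ4 z hzn
      have hz'A : φ z' ∈ φ '' Q := ⟨z', ⟨hz'.ge, hz'.le.trans hρR₂⟩, rfl⟩
      calc f (φ z) ≤ D.metric.edist hg p (φ z') + D.metric.edist hg (φ z') (φ z) :=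
            PseudoRiemannianMetric.edist_triangle hg _ _ _
        _ ≤ f x₀ + ENNReal.ofReal c :=
            add_le_add (hx₀ hz'A) (by rw [PseudoRiemannianMetric.edist_comm]; exact hdist)
    · -- outer part: `‖z‖² ≤ r² + a² < R² + a²`
      have hzR : Kerr.radius a (E4.ofTimeSpace 0 (z : E3)) < R := hz
      have h0 := Kerr.radius_nonneg a (E4.ofTimeSpace 0 (z : E3))
      have hz2 : ‖(z : E3)‖ ≤ Real.sqrt (R ^ 2 + a ^ 2) :=
        (Real.le_sqrt (norm_nonneg _) (by positivity)).2 (by nlinarith [hle z])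
      have hzA : φ z ∈ φ '' Q := ⟨z, ⟨not_lt.1 hzn, by linarith⟩, rfl⟩
      exact (hx₀ hzA).trans le_self_add
  have hK := Literature.Geometry.Riemannian.isCompact_closure_of_forall_edist_le D.metric le_rfl
    hg hc p hB
  exact ⟨(Set.range φ)ᶜ ∪ closure _, hC.union hK, subset_union_left,
    subset_closure.trans subset_union_right⟩

/-! ## The stub -/

/-- **Stub `stub_shieldCocompact` of line `scri-transfer-third-of-burial` (crux
`PhaseMixingCapture.WeakCosmicCensorshipMGHD`): far shield regions of an admissible Kerr-shielded
datum are co-compact in `X`.**  For `D ∈ admissibleVacuumData X` (in particular complete;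
Christodoulou, CQG 16 (1999), p. A24) shielded through the smooth open embedding
`φ : Kerr.slice a r₁ → X` with compact complement and `φ^* h = ψ^* g_{M,a}` for the bent slice
`ψ`, and every `R`, there is a compact `K ⊆ X` with `Kᶜ ⊆ φ {R ≤ r}`: the compact core
`K = (range φ)ᶜ ∪ closure (φ{r < R})` of `exists_isCompact_core` (Hopf–Rinow for the complete
metric `h`; O'Neill 1983, Ch. 5, Thm. 21). [cite: Christodoulou1999, p. A24] [cite: ONeill1983, Ch. 5, Thm. 21] -/
theorem stub_shieldCocompact : ∀ [Kerr.Facts] (X : Type) [TopologicalSpace X] [ChartedSpace E3 X] [IsManifold (𝓡 3) ∞ X] [T2Space X] [SecondCountableTopology X] [ConnectedSpace X] (D : InitialDataSet (𝓡 3) X), D ∈ admissibleVacuumData X → ∀ (M a r₁ : ℝ) (hM : 0 ≤ M) (φ : Kerr.slice a r₁ → X) (ψ : Kerr.slice a r₁ → Kerr.region a r₁) (ν : NormalField 𝓘(ℝ, E4) ψ), (|a| < M ∧ Kerr.rMinus M a < r₁ ∧ r₁ < Kerr.rPlus M a ∧ IsCompact (Set.range φ)ᶜ ∧ Topology.IsOpenEmbedding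 φ ∧ ContMDiff 𝓘(ℝ, E3) (𝓡 3) ∞ φ ∧ (∀ y : Kerr.slice a r₁, (ψ y : E4) = E4.ofTimeSpace (bentHeight M a (Kerr.radius a (E4.ofTimeSpace 0 (y : E3)))) (y : E3)) ∧ (Kerr.smoothMetric M a r₁).IsSpacelikeImmersion 𝓘(ℝ, E3) ψ ∧ (Kerr.smoothMetric M a r₁).IsFutureUnitNormal 𝓘(ℝ, E3) ((Kerr.timeOrientation M a r₁ hM).ofLE le_top) ψ ν ∧ (∀ y : Kerr.slice a r₁, pullbackBilin (I := 𝓡 3) (I' := 𝓘(ℝ, E3)) φ D.h.inner y = pullbackBilin (I := 𝓘(ℝ, E4)) (I' := 𝓘(ℝ, E3)) ψ (Kerr.smoothMetric M a r₁).val y) ∧ (∀ [(Kerr.smoothMetric M a r₁).HasLeviCivita] (y : Kerr.slice a r₁), (pullbackBilin (I := 𝓡 3) (I' := 𝓘(ℝ, E3)) φ D.k y).toLinearMap₁₂ = (Kerr.smoothMetric M a r₁).secondFundamentalForm 𝓘(ℝ, E3) ψ ν y)) → ∀ R : ℝ, ∃ K : Set X, IsCompact K ∧ Kᶜ ⊆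 φ '' {y : Kerr.slice a r₁ | R ≤ Kerr.radius a (E4.ofTimeSpace 0 (y : E3))} := by
  intro _ X _ _ _ _ _ _ D hD M a r₁ hM φ ψ ν hS R
  obtain ⟨ha, hr₁, hr₂, hC, hφo, hφs, hψ, -, -, hh, -⟩ := hS
  obtain ⟨K, hK, hCK, hBK⟩ := exists_isCompact_core hD ha hr₁ hr₂ hC hφo hφs hψ hh R
  refine ⟨K, hK, fun x hx ↦ ?_⟩
  have hxφ : x ∈ Set.range φ := by
    by_contra h
    exact hx (hCK h)
  obtain ⟨y, rfl⟩ := hxφ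
  exact ⟨y, (not_lt.1 fun hlt ↦ hx (hBK ⟨y, hlt, rfl⟩) :
    R ≤ Kerr.radius a (E4.ofTimeSpace 0 (y : E3))), rfl⟩

end Summit.FinalStateConjecture.FinalStateConjecture.Theorems.PhaseMixingCapture.WeakCosmicCensorshipMGHD

end
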